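import Mathlib
import HarnessLib
import Summits.Ventures.LatticeQCDFlow.Scaling.GeometricProtocol
import Summits.Ventures.LatticeQCDFlow.Scaling.PerfectRelaxationTelescoping
import Summits.Ventures.LatticeQCDFlow.Scaling.VarianceFloorLayerLaw
import Summits.Ventures.LatticeQCDFlow.TrivializingMaps.ReweightingStepLaw
import Summits.Ventures.LatticeQCDFlow.Scaling.SpecificHeatProtocolLaw

/-!
HONEST FRAMING: exact (Metropolis-corrected) sampling algorithms for lattice gauge theory; figures
of merit are autocorrelation/cost numbers at stated couplings and volumes; no continuum-physics
claim.

# SpecificHeatFloorLog2Law — A SPECIFIC-HEAT FLOOR `Var_β(S) ≥ K/β²` FORCES THE `log² R` LAYER LAW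
# FOR EVERY ANNEALING PROTOCOL, AND A CEILING `Var_β(S) ≤ K'/β²` MAKES THE GEOMETRIC PROTOCOL ATTAIN IT
# (theory2 GEN-38, item 125 PART 2 of 2, OURS; custody landing lean-2 GEN-9 per LEAD LINE 245 —
# statements and proofs = HOME/lean/theory2/SpecificHeatFloorLog2Law.lean dc3e6ab7381136de §3–§5; the
# abstract three-point inequality is PART 1, `SpecificHeatProtocolLaw`; header trimmed)

Venture `LatticeQCDFlow` (cell pub-lqcd), topic `Scaling`, FANOUT row 29 (THEORY-2.md v5.2 §3.5 (ix-c)).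
* §3 (calculus bridge).  `K/t² ≤ ψ″(t)` on `[β₀, ∞)` ⟹ `ψ + K log` convex there; `ψ″ ≤ K'/t²` ⟹
  `ψ + K' log` concave (`convexOn_add_mul_log_of_floor`, `concaveOn_add_mul_log_of_ceiling`).
* §4 (finite exponential families `p_β ∝ e^{−βA}`, the tree's T2 world).  `−log Π_j ESS(p_{b_{j+1}},
  p_{b_j}) = protocolCost (logPartFn A) b` for EVERY protocol (`negLog_prod_essFrac_eq_protocolCost`),
  so a specific-heat floor gives `Π_j ESS ≤ exp(−K U²/(n+U))` and the layer count
  (`prod_essFrac_le_exp_of_convex`, `layers_necessary_expFamily`) — the SCALE-regime (`log² R`) layer law.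
* §5 (lattice gauge theory, Lüscher's ambient setting of the tree's `TrivializingMaps/ReweightingStepLaw`:
  any smooth action `S` on `SU(N)^E`, every `d`, `L`, `N`).  With `E_β[w²] := E_{μ_β}[(dμ_{β+δ}/dμ_β)²]`
  (`weightSqMoment`), **`Σ_j log E_{b_j}[w_j²] = protocolCost ψ_S b`** exactly
  (`sum_log_weightSqMoment_eq_protocolCost`); the typed hypothesis
  **(SH) `SpecificHeatFloor S β₀ K : ∀ u ≥ β₀, K/u² ≤ Var_u(S)`** gives, for every protocol in
  `[β₀, ∞)`, **`Π_j E_{b_j}[w_j²] ≥ exp(K log²R/(n + log R))`** and `n ≥ K log²R/t − log R`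
  (`protocolLaw_of_specificHeatFloor`, `prod_weightSqMoment_ge_exp`, `layers_necessary_lattice`); the
  ceiling gives `≤ exp(K' log²R/n)` along the geometric protocol (`geomProtocol_layers_sufficient_lattice`).
  Specialised to the Wilson action (`wilson_protocolLaw_of_specificHeatFloor`) with `K = c·#plaquettes`:
  **`n ≥ c·#plaq·log²R/t − log R` exact reweighting layers between couplings `β₀` and `Rβ₀`** —
  conjecture C6's lattice side, conditionally on (SH_W).

## Status of the hypothesis (SH) — RECORDED HONESTLY, NOT PROVED HERE

`WilsonSpecificHeatFloor d L N β₀ c` (= (SH) for `S = S_W`, `K = c·#plaq`) and `WilsonSpecificHeatFloorUniform`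
are TYPED HYPOTHESES (`@[conjecture] def`).  Known: a CONSTANT floor at strong coupling (`StrongCouplingSpecificHeat`)
and an extensive floor `e^{−c|β|}·#sites` on every BOUNDED window, every compact group (theory2 item 126;
`TrivializingMaps/WilsonVarianceFloorAllCouplings`) — neither gives the `K/u²` TAIL, OPEN for non-abelian `G`.  NOT CLAIMED: (SH) itself; any finite-sample ESS
statement; imperfect relaxation, autocorrelations, the continuum.  (Full discussion: HOME header / LANDING §36.)
-/

noncomputable section

namespace Summit.Ventures.LatticeQCDFlow.Theory2.SpecificHeat

open Finset Set Real

/-! ## §3. Calculus bridge: a second-derivative floor `K/t²` is convexity of `ψ + K log` -/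

/-- **`K/t² ≤ ψ″(t)` on `[β₀, ∞)` ⟹ `ψ + K log` is convex on `[β₀, ∞)`** (`β₀ > 0`; `ψ′`, `ψ″` given as
`HasDerivAt` data). [folklore] -/
theorem convexOn_add_mul_log_of_floor {ψ ψ' V : ℝ → ℝ} {K β₀ : ℝ} (hβ₀ : 0 < β₀)
    (hψ : ∀ t, HasDerivAt ψ (ψ' t) t) (hψ' : ∀ t, HasDerivAt ψ' (V t) t)
    (hfloor : ∀ t, β₀ ≤ t → K / t ^ 2 ≤ V t) :
    ConvexOn ℝ (Ici β₀) (fun t => ψ t + K * Real.log t) := by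
  have hpos : ∀ t ∈ Ici β₀, 0 < t := fun t ht => lt_of_lt_of_le hβ₀ ht
  have hf : ∀ t, 0 < t → HasDerivAt (fun t => ψ t + K * Real.log t) (ψ' t + K * t⁻¹) t :=
    fun t ht => (hψ t).add ((Real.hasDerivAt_log ht.ne').const_mul K)
  have hg : ∀ t, 0 < t → HasDerivAt (fun t => ψ' t + K * t⁻¹) (V t + K * (-(t ^ 2)⁻¹)) t :=
    fun t ht => (hψ' t).add ((hasDerivAt_inv ht.ne').const_mul K)
  have hgmono : MonotoneOn (fun t => ψ' t + K * t⁻¹) (Ici β₀) := by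
    refine monotoneOn_of_deriv_nonneg (convex_Ici β₀) ?_ ?_ ?_
    · exact fun t ht => (hg t (hpos t ht)).continuousAt.continuousWithinAt
    · intro t ht
      rw [interior_Ici] at ht
      exact (hg t (lt_trans hβ₀ (Set.mem_Ioi.1 ht))).differentiableAt.differentiableWithinAt
    · intro t ht
      rw [interior_Ici] at ht
      have ht0 : 0 < t := lt_trans hβ₀ (Set.mem_Ioi.1 ht)
      rw [(hg t ht0).deriv]
      have h := hfloor t (Set.mem_Ioi.1 ht).le
      have h' : K * (-(t ^ 2)⁻¹) = -(K / t ^ 2) := by ring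
      rw [h']
      linarith
  refine MonotoneOn.convexOn_of_deriv (convex_Ici β₀) ?_ ?_ ?_
  · exact fun t ht => (hf t (hpos t ht)).continuousAt.continuousWithinAt
  · intro t ht
    rw [interior_Ici] at ht
    exact (hf t (lt_trans hβ₀ (Set.mem_Ioi.1 ht))).differentiableAt.differentiableWithinAt
  · rw [interior_Ici]
    intro s hs t ht hst
    rw [(hf s (lt_trans hβ₀ (Set.mem_Ioi.1 hs))).deriv, (hf t (lt_trans hβ₀ (Set.mem_Ioi.1 ht))).deriv]
    exact hgmono (Set.mem_Ici.2 (Set.mem_Ioi.1 hs).le) (Set.mem_Ici.2 (Set.mem_Ioi.1 ht).le) hst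

/-- **`ψ″(t) ≤ K/t²` on `[β₀, ∞)` ⟹ `ψ + K log` is concave on `[β₀, ∞)`**. [folklore] -/
theorem concaveOn_add_mul_log_of_ceiling {ψ ψ' V : ℝ → ℝ} {K β₀ : ℝ} (hβ₀ : 0 < β₀)
    (hψ : ∀ t, HasDerivAt ψ (ψ' t) t) (hψ' : ∀ t, HasDerivAt ψ' (V t) t)
    (hceil : ∀ t, β₀ ≤ t → V t ≤ K / t ^ 2) :
    ConcaveOn ℝ (Ici β₀) (fun t => ψ t + K * Real.log t) := by
  have hpos : ∀ t ∈ Ici β₀, 0 < t := fun t ht => lt_of_lt_of_le hβ₀ ht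
  have hf : ∀ t, 0 < t → HasDerivAt (fun t => ψ t + K * Real.log t) (ψ' t + K * t⁻¹) t :=
    fun t ht => (hψ t).add ((Real.hasDerivAt_log ht.ne').const_mul K)
  have hg : ∀ t, 0 < t → HasDerivAt (fun t => ψ' t + K * t⁻¹) (V t + K * (-(t ^ 2)⁻¹)) t :=
    fun t ht => (hψ' t).add ((hasDerivAt_inv ht.ne').const_mul K)
  have hganti : AntitoneOn (fun t => ψ' t + K * t⁻¹) (Ici β₀) := by
    refine antitoneOn_of_deriv_nonpos (convex_Ici β₀) ?_ ?_ ?_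
    · exact fun t ht => (hg t (hpos t ht)).continuousAt.continuousWithinAt
    · intro t ht
      rw [interior_Ici] at ht
      exact (hg t (lt_trans hβ₀ (Set.mem_Ioi.1 ht))).differentiableAt.differentiableWithinAt
    · intro t ht
      rw [interior_Ici] at ht
      have ht0 : 0 < t := lt_trans hβ₀ (Set.mem_Ioi.1 ht)
      rw [(hg t ht0).deriv]
      have h := hceil t (Set.mem_Ioi.1 ht).le
      have h' : K * (-(t ^ 2)⁻¹) = -(K / t ^ 2) := by ring
      rw [h']
      linarith
  refine AntitoneOn.concaveOn_of_deriv (convex_Ici β₀) ?_ ?_ ?_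
  · exact fun t ht => (hf t (hpos t ht)).continuousAt.continuousWithinAt
  · intro t ht
    rw [interior_Ici] at ht
    exact (hf t (lt_trans hβ₀ (Set.mem_Ioi.1 ht))).differentiableAt.differentiableWithinAt
  · rw [interior_Ici]
    intro s hs t ht hst
    rw [(hf s (lt_trans hβ₀ (Set.mem_Ioi.1 hs))).deriv, (hf t (lt_trans hβ₀ (Set.mem_Ioi.1 ht))).deriv]
    exact hganti (Set.mem_Ici.2 (Set.mem_Ioi.1 hs).le) (Set.mem_Ici.2 (Set.mem_Ioi.1 ht).le) hst

/-! ## §4. Finite exponential families: `−log Π ESS = protocolCost F`, hence the layer law -/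

section ExpFamily

open Summit.Ventures.LatticeQCDFlow.Exactness

variable {X : Type*} [Fintype X] [Nonempty X] {n : ℕ}

/-- Each one-step ESS of a protocol is positive. [folklore] -/
theorem essFrac_protocol_pos (A : X → ℝ) (b : Fin (n + 1) → ℝ) (k : Fin n) :
    0 < essFrac (gibbsLaw fun x => b k.succ * A x) (gibbsLaw fun x => b k.castSucc * A x) := by
  have h := essFrac_expFamily_pos A (b k.castSucc) (b k.succ - b k.castSucc)
  rwa [add_sub_cancel] at h

/-- **`−log Π_j ESS(p_{b_{j+1}}, p_{b_j}) = protocolCost (logPartFn A) b`** for EVERY protocol on the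
finite exponential family `p_β ∝ e^{−βA}` (tree `negLog_essFrac_expFamily`, summed). [ours] -/
theorem negLog_prod_essFrac_eq_protocolCost (A : X → ℝ) (b : Fin (n + 1) → ℝ) :
    -Real.log (∏ k : Fin n, essFrac (gibbsLaw fun x => b k.succ * A x)
        (gibbsLaw fun x => b k.castSucc * A x)) = protocolCost (logPartFn A) b := by
  rw [Real.log_prod (fun k _ => (essFrac_protocol_pos A b k).ne'), ← Finset.sum_neg_distrib,
    protocolCost]
  refine Finset.sum_congr rfl fun k _ => ?_
  have h := negLog_essFrac_expFamily A (b k.castSucc) (b k.succ - b k.castSucc)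
  rw [add_sub_cancel, show b k.castSucc + 2 * (b k.succ - b k.castSucc) =
    2 * b k.succ - b k.castSucc by ring] at h
  exact h

/-- **FINITE-STATE `log² R` LAYER LAW.**  If `β ↦ logPartFn A β + K log β` is convex on `[β₀, ∞)`
(`K ≥ 0`, `β₀ > 0`: specific-heat floor `Var_β(A) ≥ K/β²`), then for EVERY monotone protocol in
`[β₀, ∞)` with `n ≥ 1` layers, **`Π_j ESS_j ≤ exp(−K·log²R/(n + log R))`**, `R = b_n/b_0`. [ours] -/
theorem prod_essFrac_le_exp_of_convex (A : X → ℝ) {K β₀ : ℝ} (hβ₀ : 0 < β₀) (hK : 0 ≤ K)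
    (hSH : ConvexOn ℝ (Ici β₀) (fun β => logPartFn A β + K * Real.log β)) (hn : 0 < n)
    (b : Fin (n + 1) → ℝ) (hb0 : β₀ ≤ b 0) (hb : Monotone b) :
    ∏ k : Fin n, essFrac (gibbsLaw fun x => b k.succ * A x) (gibbsLaw fun x => b k.castSucc * A x) ≤
      Real.exp (-(K * (Real.log (b (Fin.last n) / b 0)) ^ 2 /
        (n + Real.log (b (Fin.last n) / b 0)))) := by
  have hpos : 0 < ∏ k : Fin n, essFrac (gibbsLaw fun x => b k.succ * A x)
      (gibbsLaw fun x => b k.castSucc * A x) :=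
    Finset.prod_pos fun k _ => essFrac_protocol_pos A b k
  rw [← Real.log_le_iff_le_exp hpos]
  have h := protocolCost_ge_sq_div hβ₀ hK hSH hn b hb0 hb
  rw [← negLog_prod_essFrac_eq_protocolCost] at h
  linarith

/-- **LAYERS NECESSARY (finite state).**  If the perfectly relaxed product ESS along the protocol is
`≥ e^{−t}` (`t > 0`) then **`n ≥ K·log²R/t − log R`**. [ours] -/
theorem layers_necessary_expFamily (A : X → ℝ) {K β₀ t : ℝ} (hβ₀ : 0 < β₀) (hK : 0 ≤ K)
    (hSH : ConvexOn ℝ (Ici β₀) (fun β => logPartFn A β + K * Real.log β)) (hn : 0 < n)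
    (b : Fin (n + 1) → ℝ) (hb0 : β₀ ≤ b 0) (hb : Monotone b) (ht : 0 < t)
    (hE : Real.exp (-t) ≤ ∏ k : Fin n, essFrac (gibbsLaw fun x => b k.succ * A x)
      (gibbsLaw fun x => b k.castSucc * A x)) :
    K * (Real.log (b (Fin.last n) / b 0)) ^ 2 / t - Real.log (b (Fin.last n) / b 0) ≤ n := by
  refine layers_necessary hβ₀ hK hSH hn b hb0 hb ht ?_
  rw [← negLog_prod_essFrac_eq_protocolCost]
  have h := Real.log_le_log (Real.exp_pos _) hE
  rw [Real.log_exp] at h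
  linarith

end ExpFamily

/-! ## §5. Lattice gauge theory (`SU(N)^E`, any smooth action): `Σ_j log E[w_j²] = protocolCost ψ_S`,
## and the layer law under the specific-heat floor (SH) -/

section LatticeGauge

open MeasureTheory ProbabilityTheory
open Literature.MathematicalPhysics.QuantumFieldTheory
open Literature.MathematicalPhysics.QuantumFieldTheory.Luscher2010
open Literature.MathematicalPhysics.QuantumFieldTheory.WilsonFlow (coeConfig)
open Summit.Ventures.LatticeQCDFlow.TrivializingMaps
open scoped ContDiff Matrix Matrix.Norms.Frobenius

variable {d L N : ℕ} [NeZero L] {S : AmbConfig d L N → ℝ} {n : ℕ}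

/-- `ψ_S(t) = log ∫ e^{−tS(U)} D[U]`: the cumulant generating function of `−S∘ι` under the product Haar
measure on `SU(N)^E` (the tree's `cgf (fun U => -S (coeConfig U)) (trivialMeasure …)`; `ψ_S″ = Var`,
tree `hasDerivAt_deriv_cgf`). [folklore] -/
def actionCGF (S : AmbConfig d L N → ℝ) (t : ℝ) : ℝ :=
  cgf (fun U => -S (coeConfig U)) (trivialMeasure (Matrix.specialUnitaryGroup (Fin N) ℂ) d L) t

/-- `Var_t(S)`: the variance of the action in the ensemble `𝒵⁻¹e^{−tS}D[U]` (the lattice "specific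
heat" is `t²·Var_t(S)/#plaq`). [folklore] -/
def actionVar (S : AmbConfig d L N → ℝ) (t : ℝ) : ℝ :=
  variance (fun U => S (coeConfig U))
    (boltzmannMeasure fun U : GaugeConfig d L (Matrix.specialUnitaryGroup (Fin N) ℂ) =>
      t * S (coeConfig U))

/-- `E_{μ_β}[w²]`, `w = dμ_{β+δ}/dμ_β = e^{−δS}·Z(β)/Z(β+δ)`: the second moment of the importance weight
of ONE exact reweighting step `β → β + δ` (`= 1 + χ²(μ_{β+δ}‖μ_β)`, the inverse asymptotic ESS fraction
of the step). [folklore] -/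
def weightSqMoment (S : AmbConfig d L N → ℝ) (β δ : ℝ) : ℝ :=
  ∫ U, (Real.exp (-(δ * S (coeConfig U))) *
      (mgf (fun U => -S (coeConfig U)) (trivialMeasure (Matrix.specialUnitaryGroup (Fin N) ℂ) d L) β /
        mgf (fun U => -S (coeConfig U)) (trivialMeasure (Matrix.specialUnitaryGroup (Fin N) ℂ) d L)
          (β + δ))) ^ 2
    ∂(boltzmannMeasure fun U : GaugeConfig d L (Matrix.specialUnitaryGroup (Fin N) ℂ) =>
      β * S (coeConfig U))

/-- `log E_{μ_β}[w²] = ψ(β) + ψ(β+2δ) − 2ψ(β+δ)` (tree `weight_sq_integral_eq`). [ours] -/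
theorem log_weightSqMoment (hS : ContDiff ℝ ∞ S) (β δ : ℝ) :
    Real.log (weightSqMoment S β δ) =
      actionCGF S β + actionCGF S (β + 2 * δ) - 2 * actionCGF S (β + δ) := by
  unfold weightSqMoment actionCGF
  rw [weight_sq_integral_eq hS β δ, Real.log_exp]
  ring

/-- `E_{μ_β}[w²] > 0`. [folklore] -/
theorem weightSqMoment_pos (hS : ContDiff ℝ ∞ S) (β δ : ℝ) : 0 < weightSqMoment S β δ := by
  unfold weightSqMoment
  rw [weight_sq_integral_eq hS β δ]
  exact Real.exp_pos _

/-- **`Σ_j log E_{μ_{b_j}}[w_j²] = protocolCost ψ_S b`** for EVERY protocol `b` (`w_j` the weight of the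
exact step `b_j → b_{j+1}`): the log of the product of the per-step second moments of sequential exact
reweighting with perfectly relaxed intermediate ensembles. [ours] -/
theorem sum_log_weightSqMoment_eq_protocolCost (hS : ContDiff ℝ ∞ S) (b : Fin (n + 1) → ℝ) :
    ∑ j : Fin n, Real.log (weightSqMoment S (b j.castSucc) (b j.succ - b j.castSucc)) =
      protocolCost (actionCGF S) b := by
  rw [protocolCost]
  refine Finset.sum_congr rfl fun j _ => ?_
  rw [log_weightSqMoment hS, add_sub_cancel, show b j.castSucc + 2 * (b j.succ - b j.castSucc) =
    2 * b j.succ - b j.castSucc by ring]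

/-- **(SH) SPECIFIC-HEAT FLOOR** for the action `S` on `[β₀, ∞)` with constant `K`:
`∀ u ≥ β₀, K/u² ≤ Var_u(S)`.  A HYPOTHESIS (for the Wilson action with `K = c·#plaq`, `c` uniform in
`L`: conjecture (SH_W), see the module docstring), never an axiom. [ours] -/
@[conjecture]
def SpecificHeatFloor (S : AmbConfig d L N → ℝ) (β₀ K : ℝ) : Prop :=
  ∀ u : ℝ, β₀ ≤ u → K / u ^ 2 ≤ actionVar S u

/-- **(SH′) SPECIFIC-HEAT CEILING**: `∀ u ≥ β₀, Var_u(S) ≤ K/u²`. [ours] -/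
@[conjecture]
def SpecificHeatCeiling (S : AmbConfig d L N → ℝ) (β₀ K : ℝ) : Prop :=
  ∀ u : ℝ, β₀ ≤ u → actionVar S u ≤ K / u ^ 2

/-- (SH) ⟹ `ψ_S + K log` convex on `[β₀, ∞)` (`ψ_S″ = Var`, tree). [ours] -/
theorem convexOn_actionCGF_of_floor (hS : ContDiff ℝ ∞ S) {β₀ K : ℝ} (hβ₀ : 0 < β₀)
    (hSH : SpecificHeatFloor S β₀ K) :
    ConvexOn ℝ (Ici β₀) (fun t => actionCGF S t + K * Real.log t) :=
  convexOn_add_mul_log_of_floor hβ₀ (fun t => hasDerivAt_cgf_neg_action hS t)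
    (fun t => hasDerivAt_deriv_cgf hS t) hSH

/-- (SH′) ⟹ `ψ_S + K log` concave on `[β₀, ∞)`. [ours] -/
theorem concaveOn_actionCGF_of_ceiling (hS : ContDiff ℝ ∞ S) {β₀ K : ℝ} (hβ₀ : 0 < β₀)
    (hSC : SpecificHeatCeiling S β₀ K) :
    ConcaveOn ℝ (Ici β₀) (fun t => actionCGF S t + K * Real.log t) :=
  concaveOn_add_mul_log_of_ceiling hβ₀ (fun t => hasDerivAt_cgf_neg_action hS t)
    (fun t => hasDerivAt_deriv_cgf hS t) hSC

/-- **LATTICE `log² R` LAYER LAW (necessity).**  For a smooth action `S` on `SU(N)^E` with the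
specific-heat floor (SH) on `[β₀, ∞)` (`K ≥ 0`), EVERY monotone protocol `β₀ ≤ b_0 ≤ … ≤ b_n` (`n ≥ 1`)
of exact reweighting steps obeys **`K·log²R/(n + log R) ≤ Σ_j log E_{μ_{b_j}}[w_j²]`**, `R = b_n/b_0`.
[ours] -/
theorem protocolLaw_of_specificHeatFloor (hS : ContDiff ℝ ∞ S) {β₀ K : ℝ} (hβ₀ : 0 < β₀) (hK : 0 ≤ K)
    (hSH : SpecificHeatFloor S β₀ K) (hn : 0 < n) (b : Fin (n + 1) → ℝ) (hb0 : β₀ ≤ b 0)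
    (hb : Monotone b) :
    K * (Real.log (b (Fin.last n) / b 0)) ^ 2 / (n + Real.log (b (Fin.last n) / b 0)) ≤
      ∑ j : Fin n, Real.log (weightSqMoment S (b j.castSucc) (b j.succ - b j.castSucc)) := by
  rw [sum_log_weightSqMoment_eq_protocolCost hS]
  exact protocolCost_ge_sq_div hβ₀ hK (convexOn_actionCGF_of_floor hS hβ₀ hSH) hn b hb0 hb

/-- Product form: **`Π_j E_{μ_{b_j}}[w_j²] ≥ exp(K·log²R/(n + log R))`**. [ours] -/
theorem prod_weightSqMoment_ge_exp (hS : ContDiff ℝ ∞ S) {β₀ K : ℝ} (hβ₀ : 0 < β₀) (hK : 0 ≤ K)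
    (hSH : SpecificHeatFloor S β₀ K) (hn : 0 < n) (b : Fin (n + 1) → ℝ) (hb0 : β₀ ≤ b 0)
    (hb : Monotone b) :
    Real.exp (K * (Real.log (b (Fin.last n) / b 0)) ^ 2 / (n + Real.log (b (Fin.last n) / b 0))) ≤
      ∏ j : Fin n, weightSqMoment S (b j.castSucc) (b j.succ - b j.castSucc) := by
  have hpos : 0 < ∏ j : Fin n, weightSqMoment S (b j.castSucc) (b j.succ - b j.castSucc) :=
    Finset.prod_pos fun j _ => weightSqMoment_pos hS _ _
  rw [← Real.le_log_iff_exp_le hpos, Real.log_prod (fun j _ => (weightSqMoment_pos hS _ _).ne')]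
  exact protocolLaw_of_specificHeatFloor hS hβ₀ hK hSH hn b hb0 hb

/-- **LAYERS NECESSARY (lattice).**  Under (SH), a protocol of exact reweighting steps from `b_0` to
`b_n = R·b_0` inside `[β₀, ∞)` with `Σ_j log E[w_j²] ≤ t` (`t > 0`) has **`n ≥ K·log²R/t − log R`**
layers. [ours] -/
theorem layers_necessary_lattice (hS : ContDiff ℝ ∞ S) {β₀ K t : ℝ} (hβ₀ : 0 < β₀) (hK : 0 ≤ K)
    (hSH : SpecificHeatFloor S β₀ K) (hn : 0 < n) (b : Fin (n + 1) → ℝ) (hb0 : β₀ ≤ b 0)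
    (hb : Monotone b) (ht : 0 < t)
    (hcost : ∑ j : Fin n, Real.log (weightSqMoment S (b j.castSucc) (b j.succ - b j.castSucc)) ≤ t) :
    K * (Real.log (b (Fin.last n) / b 0)) ^ 2 / t - Real.log (b (Fin.last n) / b 0) ≤ n := by
  rw [sum_log_weightSqMoment_eq_protocolCost hS] at hcost
  exact layers_necessary hβ₀ hK (convexOn_actionCGF_of_floor hS hβ₀ hSH) hn b hb0 hb ht hcost

/-- **PER-STEP WINDOW LAW (lattice).**  Under (SH) with `K > 0`, if every exact reweighting step of
the protocol has `log E[w_j²] ≤ t₀` (an `O(1)` window per step) then **`log R ≤ n·(t₀/K + √(t₀/K))`**: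
at least `½√(K/t₀)·log R` steps for `t₀ ≤ K` — with `K = c·#plaq`, the `√V·log R` law of reweighting
windows / replica ladders as a theorem under (SH). [ours] -/
theorem logRatio_le_of_stepCost_lattice (hS : ContDiff ℝ ∞ S) {β₀ K t₀ : ℝ} (hβ₀ : 0 < β₀)
    (hK : 0 < K) (hSH : SpecificHeatFloor S β₀ K) (b : Fin (n + 1) → ℝ) (hb0 : β₀ ≤ b 0)
    (hb : Monotone b) (ht : 0 ≤ t₀)
    (hstep : ∀ j : Fin n, Real.log (weightSqMoment S (b j.castSucc) (b j.succ - b j.castSucc)) ≤ t₀) :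
    Real.log (b (Fin.last n) / b 0) ≤ n * (t₀ / K + Real.sqrt (t₀ / K)) := by
  refine logRatio_le_of_stepCost hβ₀ hK (convexOn_actionCGF_of_floor hS hβ₀ hSH) b hb0 hb ht
    fun j => ?_
  have h := hstep j
  rw [log_weightSqMoment hS, add_sub_cancel, show b j.castSucc + 2 * (b j.succ - b j.castSucc) =
    2 * b j.succ - b j.castSucc by ring] at h
  exact h

/-- **LATTICE `log² R` LAYER LAW (sufficiency along the geometric protocol).**  Under the ceiling (SH′)
with `K ≥ 0`, the geometric protocol `b_j = β₀e^{jU/n}` (`U ≥ 0`, `n ≥ 1`) has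
**`Σ_j log E_{μ_{b_j}}[w_j²] ≤ K·U²/n`**. [ours] -/
theorem geomProtocolLaw_of_specificHeatCeiling (hS : ContDiff ℝ ∞ S) {β₀ K U : ℝ} (hβ₀ : 0 < β₀)
    (hK : 0 ≤ K) (hU : 0 ≤ U) (hSC : SpecificHeatCeiling S β₀ K) (hn : 0 < n) :
    ∑ j : Fin n, Real.log (weightSqMoment S (geomProtocol β₀ U n j.castSucc)
        (geomProtocol β₀ U n j.succ - geomProtocol β₀ U n j.castSucc)) ≤ K * U ^ 2 / n := by
  rw [sum_log_weightSqMoment_eq_protocolCost hS]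
  exact protocolCost_geomProtocol_le hβ₀ hK hU (concaveOn_actionCGF_of_ceiling hS hβ₀ hSC) hn

/-- **LAYERS SUFFICIENT (lattice).**  Under (SH′), `n ≥ K·U²/t` geometric layers give
`Σ_j log E[w_j²] ≤ t`. [ours] -/
theorem geomProtocol_layers_sufficient_lattice (hS : ContDiff ℝ ∞ S) {β₀ K U t : ℝ} (hβ₀ : 0 < β₀)
    (hK : 0 ≤ K) (hU : 0 ≤ U) (hSC : SpecificHeatCeiling S β₀ K) (hn : 0 < n) (ht : 0 < t)
    (hnt : K * U ^ 2 / t ≤ n) :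
    ∑ j : Fin n, Real.log (weightSqMoment S (geomProtocol β₀ U n j.castSucc)
        (geomProtocol β₀ U n j.succ - geomProtocol β₀ U n j.castSucc)) ≤ t := by
  rw [sum_log_weightSqMoment_eq_protocolCost hS]
  exact geomProtocol_layers_sufficient hβ₀ hK hU (concaveOn_actionCGF_of_ceiling hS hβ₀ hSC) hn ht hnt

/-! ### The Wilson action: conjecture (SH_W) and the conditional `c·#plaq·log²R` layer law -/

/-- **CONJECTURE (SH_W)** — specific-heat floor of the `SU(N)` Wilson action in volume `L^d` on
`[β₀, ∞)`: `Var_u(S_W) ≥ c·#plaquettes/u²` for all `u ≥ β₀`.  TYPED HYPOTHESIS, not proved, not an axiom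
(expected `c ≈ (N²−1)/d` from the Gaussian count; see the module docstring for what is known). [ours] -/
@[conjecture]
def WilsonSpecificHeatFloor (d L N : ℕ) [NeZero L] (β₀ c : ℝ) : Prop :=
  SpecificHeatFloor (ambWilsonAction : AmbConfig d L N → ℝ) β₀ (c * Fintype.card (Plaquette d L))

/-- **CONJECTURE (SH_W), uniform in the volume**: one constant `c` for all `L ≥ 2`. [ours] -/
@[conjecture]
def WilsonSpecificHeatFloorUniform (d N : ℕ) (β₀ c : ℝ) : Prop :=
  ∀ (L : ℕ) [NeZero L], 2 ≤ L → WilsonSpecificHeatFloor d L N β₀ c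

/-- **WILSON `log² R` LAYER LAW, CONDITIONAL ON (SH_W).**  For the `SU(N)` Wilson action in volume
`L^d`, if `Var_u(S_W) ≥ c·#plaq/u²` on `[β₀, ∞)` (`c ≥ 0`), then EVERY monotone protocol of exact
reweighting steps `β₀ ≤ b_0 ≤ … ≤ b_n` obeys
**`c·#plaq·log²R/(n + log R) ≤ Σ_j log E_{μ_{b_j}}[w_j²]`**, `R = b_n/b_0`. [ours] -/
theorem wilson_protocolLaw_of_specificHeatFloor {β₀ c : ℝ} (hβ₀ : 0 < β₀) (hc : 0 ≤ c)
    (hSH : WilsonSpecificHeatFloor d L N β₀ c) (hn : 0 < n) (b : Fin (n + 1) → ℝ) (hb0 : β₀ ≤ b 0)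
    (hb : Monotone b) :
    c * Fintype.card (Plaquette d L) * (Real.log (b (Fin.last n) / b 0)) ^ 2 /
        (n + Real.log (b (Fin.last n) / b 0)) ≤
      ∑ j : Fin n, Real.log (weightSqMoment (ambWilsonAction : AmbConfig d L N → ℝ) (b j.castSucc)
        (b j.succ - b j.castSucc)) :=
  protocolLaw_of_specificHeatFloor contDiff_ambWilsonAction hβ₀ (by positivity) hSH hn b hb0 hb

/-- **WILSON LAYERS NECESSARY, CONDITIONAL ON (SH_W)**: `Σ_j log E[w_j²] ≤ t` forces
**`n ≥ c·#plaq·log²R/t − log R`** — linear in the VOLUME times `log²` of the coupling ratio, for every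
protocol (conjecture C6's lattice side, modulo (SH_W)). [ours] -/
theorem wilson_layers_necessary {β₀ c t : ℝ} (hβ₀ : 0 < β₀) (hc : 0 ≤ c)
    (hSH : WilsonSpecificHeatFloor d L N β₀ c) (hn : 0 < n) (b : Fin (n + 1) → ℝ) (hb0 : β₀ ≤ b 0)
    (hb : Monotone b) (ht : 0 < t)
    (hcost : ∑ j : Fin n, Real.log (weightSqMoment (ambWilsonAction : AmbConfig d L N → ℝ)
      (b j.castSucc) (b j.succ - b j.castSucc)) ≤ t) :
    c * Fintype.card (Plaquette d L) * (Real.log (b (Fin.last n) / b 0)) ^ 2 / t -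
        Real.log (b (Fin.last n) / b 0) ≤ n :=
  layers_necessary_lattice contDiff_ambWilsonAction hβ₀ (by positivity) hSH hn b hb0 hb ht hcost

/-- **WILSON PER-STEP WINDOW LAW, CONDITIONAL ON (SH_W)**: if every exact reweighting step has
`log E[w_j²] ≤ t₀` then **`log R ≤ n·(t₀/K + √(t₀/K))`** with `K = c·#plaq` — at least
`½·√(c·#plaq/t₀)·log R` windows for `t₀ ≤ K`: the `√V·log R` window-count law, for every protocol,
modulo (SH_W). [ours] -/
theorem wilson_logRatio_le_of_stepCost {β₀ c t₀ : ℝ} (hβ₀ : 0 < β₀)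
    (hK : 0 < c * Fintype.card (Plaquette d L)) (hSH : WilsonSpecificHeatFloor d L N β₀ c)
    (b : Fin (n + 1) → ℝ) (hb0 : β₀ ≤ b 0) (hb : Monotone b) (ht : 0 ≤ t₀)
    (hstep : ∀ j : Fin n, Real.log (weightSqMoment (ambWilsonAction : AmbConfig d L N → ℝ)
      (b j.castSucc) (b j.succ - b j.castSucc)) ≤ t₀) :
    Real.log (b (Fin.last n) / b 0) ≤
      n * (t₀ / (c * Fintype.card (Plaquette d L)) +
        Real.sqrt (t₀ / (c * Fintype.card (Plaquette d L)))) :=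
  logRatio_le_of_stepCost_lattice contDiff_ambWilsonAction hβ₀ hK hSH b hb0 hb ht hstep

end LatticeGauge

end Summit.Ventures.LatticeQCDFlow.Theory2.SpecificHeat
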